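/-
Copyright (c) 2026 the pub-hodgecm-mathlib formalisation cell (harness21).  Prover seat hodgecm-mathlib-K2Liu-p13 (g3), Track B «K2-LIT»,
#184♮ = hLiu418 = `stmt-HodgeConjecture-24832`; ROAD Φ (RULING «M-156n»), consumer sheet fa2b1e3a29709f09 row G6-fin, clause (v) of the big-cell package —
letter `K2LiuIntertwiningDeltaEquivariance`, part (a) (K2E5-plan (g7) co-deal 2026-09-04T14:22:38Z (C) (F4); LEAD F0P6-plan (g14) BATCH #30 ∕ #32 (2));
census `K2/K2Liu-p13/g3/CENSUS-G6fin-Phi8FacePackaging.K2Liu-p13-g3.md` 065e2d080ef468d9 (F4).  THEOREMS ONLY (no `def`, no `instance`, no named-fact hypothesis,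
no `sorry`); the modulus of `Ad(P_Δ(𝔸))` on `N_Δ(𝔸)` and the Levi homomorphism are taken BY VALUE.
-/
import Summits.HodgeConjecture.HodgeConjecture.Theorems.K2LiuSiegelRationalLeviDecomposition   -- ★ `Λ`∕`hΛ` letters, `mem_unipDelta_of_deltaBlock_eq_one`, `conj_mem_unipDelta`
import Summits.HodgeConjecture.HodgeConjecture.Theorems.K2LiuIntertwiningCentralRayEigen        -- ★ `blk_weylDelta_mul_mul_weylDelta_of_blk_eq_levi` (the template)
import Summits.HodgeConjecture.HodgeConjecture.Theorems.K2LiuModDeltaHeightComparison           -- ★ `exists_gl_coe_eq_deltaBlock`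
import HarnessLib

/-!
# Crux `HLiu418`, ROAD Φ, organ Φ8 (sheet row G6-fin): THE LEVI LAW OF THE GLOBAL SIEGEL INTERTWINING INTEGRAL —
# `M f (p h) = θ(p) · δ_{χ,s}(w_Δ m w_Δ) · M f (h)` for `p = m·n₀ ∈ P_Δ(𝔸)`, and the adelic Levi decomposition `P_Δ(𝔸) = Λ(GL_n(𝔸_L)) · N_Δ(𝔸)`

Cell `hodgecm-mathlib`, crux item hLiu418 = `stmt-HodgeConjecture-24832` (helper lane, count-neutral).  GENERIC `n`, doubled frame `H(𝔸) = HA L e dV hdV dW hdW`,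
`N_Δ(𝔸) = unipDelta` with a caller-supplied Borel structure, `M f (h) = intertwiningDelta νN f h = ∫_{N_Δ(𝔸)} f(w_Δ u h) dνN(u)` (★ D9).
This is the GLOBAL twin of the local intertwining property ★ `K2LiuLocalIntertwiningProperty.isLocalSiegelSection_localIntertwining_of_modulus`, part (a):
* §1 **ADELIC LEVI DECOMPOSITION** `exists_levi_mul_unip`: with the Levi homomorphism `Λ : GL_n(𝔸_L) →* H(𝔸)` BY VALUE (`hΛ : blk (Λ g) = R·diag(g, g♯)·R⁻¹`, as in
  ★ `K2LiuSiegelRationalLeviDecomposition`; supplied by ★ `K2LiuSiegelDoubledLeviMatrix.exists_leviHom`), every `p ∈ P_Δ(𝔸)` is `p = Λ g · n₀` with `n₀ ∈ N_Δ(𝔸)`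
  and `g = p|_Δ` the `Δ`-block (★ `K2LiuModDeltaHeightComparison.exists_gl_coe_eq_deltaBlock`, ★ `mem_unipDelta_of_deltaBlock_eq_one`);
* §2 **THE LEVI LAW** `intertwiningDelta_levi_unip_mul`: for a Siegel section `f ∈ I(s, χ)` (★ `IsSiegelDeltaSection`), `p = m · n₀` with `blk m = R·diag(A, D)·R⁻¹`
  and `n₀ ∈ N_Δ(𝔸)`, and the MODULUS BY VALUE `(u ↦ p⁻¹ u p)_* νN = θ • νN` (the module `|det_Δ p|_𝔸^{n}` of `Ad(p)` on `N_Δ(𝔸) ≅ Herm_n(𝔸_L)`; ★ only on the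
  central ray, `K2LiuIntertwiningCentralRayEigen.map_conj_centralRay_eq_smul`):
  `M f (p h) = θ.toReal · δ_{χ,s}(w_Δ m w_Δ) · M f (h)` — `u p = p (p⁻¹ u p)` (a measurable equivalence scaled by `θ`), `w_Δ m = (w_Δ m w_Δ) w_Δ` with
  `w_Δ m w_Δ ∈ P_Δ(𝔸)` of blocks `diag(D, A)` (★ `blk_weylDelta_mul_mul_weylDelta_of_blk_eq_levi`), the section law, and left invariance under `n₀`;
  NO integrability hypothesis (valid for the Bochner junk value too), exactly as ★ `intertwiningDelta_centralRay`;
* §3 `intertwiningDelta_siegel_mul` — the two combined: for every `p ∈ P_Δ(𝔸)`, `M f (p h) = θ.toReal · δ_{χ,s}(w_Δ (Λ p|_Δ) w_Δ) · M f (h)`.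
Part (b) (`K2LiuIntertwiningDeltaEquivariance`) evaluates `δ_{χ,s}(w_Δ (Λ g) w_Δ) = χ′(det g)·|det g|_𝔸^{−(s + n∕2)}` (`χ′ = (χ ∘ c)⁻¹`) and, with `θ = |det_Δ p|_𝔸^{n}`,
concludes `M f ∈ I(−s, χ′)` — the `heqv` binder of ★ `K2LiuBigCellGrowthOfEquivariance.growth_of_equivariance`.
Sources: [MoeglinWaldspurger1995, II.1.6 (intertwining operators `M(w, π)`), I.2.1]; [HarrisKudlaSweet1996, §1 (1.11)–(1.15), §6 (6.14)]; [Casselman1980, §3];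
[Garrett2018, §3.10 (`d(m n m⁻¹) = δ(m) dn`)].
HONEST LABEL.  Helper lemmas, count-neutral; `HC_CM` is proved only modulo the 7 printed citations (2 remaining named inputs:
hLiu418 = `stmt-HodgeConjecture-24832`, h413 = `stmt-HodgeConjecture-24833`) until rung 0 closes.
-/

set_option autoImplicit false
set_option linter.dupNamespace false -- the mandated namespace repeats `HodgeConjecture.HodgeConjecture`

noncomputable section

open scoped Matrix NNReal ENNReal
open NumberField IsDedekindDomain MeasureTheory MeasureTheory.Measure

namespace Summit.HodgeConjecture.HodgeConjecture.Cruxes.HLiu418.K2LiuIntertwiningDeltaLeviLaw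

open Literature.NumberTheory.GelbartRogawski1991.AdaptedBlocks
open Literature.NumberTheory.Automorphic Literature.NumberTheory.Automorphic.UnitaryGroup
open Literature.NumberTheory.GelbartRogawski1991 Literature.NumberTheory.GelbartRogawski1991.GRConstruction
open Literature.NumberTheory.K2Lit.SiegelDoubled Literature.NumberTheory.GaloisRepresentations
open UnitaryDualPair
open Summit.HodgeConjecture.HodgeConjecture.Cruxes.HLiu418.K2LiuSiegelDoubledLeviMatrix
open Summit.HodgeConjecture.HodgeConjecture.Cruxes.HLiu418.K2LiuSiegelRationalLeviDecomposition
open Summit.HodgeConjecture.HodgeConjecture.Cruxes.HLiu418.K2LiuSiegelLeviConjUnipDeltaChar (conj_mem_unipDelta)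
open Summit.HodgeConjecture.HodgeConjecture.Cruxes.HLiu418.K2LiuIntertwiningCentralRayEigen (blk_weylDelta_mul_mul_weylDelta_of_blk_eq_levi)
open Summit.HodgeConjecture.HodgeConjecture.Cruxes.HLiu418.K2LiuModDeltaHeightComparison (exists_gl_coe_eq_deltaBlock)

variable (L : Type) [Field L] [NumberField L] [IsCMField L]
variable {N M n : ℕ} (e : Fin N × Fin M ≃ Fin n)
  (dV : Fin N → L) (hdV : ∀ i, IsCMField.complexConj L (dV i) = dV i)
  (dW : Fin M → L) (hdW : ∀ i, IsCMField.complexConj L (dW i) = dW i)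

/-! ## §1 The adelic Levi decomposition `p = Λ(p|_Δ) · n₀` -/

section Levi

variable (Λ : GL (Fin n) (AdeleRing (𝓞 L) L) →* HA L e dV hdV dW hdW)
  (hΛ : ∀ g : GL (Fin n) (AdeleRing (𝓞 L) L), blk L e dV hdV dW hdW (Λ g) =
    cayR (AdeleRing (𝓞 L) L) (Fin n) * Matrix.fromBlocks (g : Matrix (Fin n) (Fin n) (AdeleRing (𝓞 L) L)) 0 0
      (((gramR L e dV hdV dW hdW).map ((algebraMap L (AdeleRing (𝓞 L) L)).comp (algebraMap (Fp L) L)))⁻¹ *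
        (((g⁻¹ : GL (Fin n) (AdeleRing (𝓞 L) L)) : Matrix (Fin n) (Fin n) (AdeleRing (𝓞 L) L)).map
          (conjAdele (Fp L) L (IsCMField.complexConj L)))ᵀ *
        (gramR L e dV hdV dW hdW).map ((algebraMap L (AdeleRing (𝓞 L) L)).comp (algebraMap (Fp L) L))) *
      cayRinv (AdeleRing (𝓞 L) L) (Fin n))

include hΛ in
/-- `(Λ g)⁻¹|_Δ = g⁻¹` (`Λ` is a homomorphism and `Λ g|_Δ = g`, ★ `deltaBlock_levi_apply`). [cite: HarrisKudlaSweet1996, §1 (1.11)] -/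
theorem deltaBlock_levi_inv_apply (g : GL (Fin n) (AdeleRing (𝓞 L) L)) :
    deltaBlock L e dV hdV dW hdW (Λ g)⁻¹ = ((g⁻¹ : GL (Fin n) (AdeleRing (𝓞 L) L)) : Matrix (Fin n) (Fin n) (AdeleRing (𝓞 L) L)) := by
  rw [← map_inv, deltaBlock_levi_apply L e dV hdV dW hdW Λ hΛ]

include hΛ in
/-- **`(Λ(p|_Δ))⁻¹ · p ∈ N_Δ(𝔸)` for `p ∈ P_Δ(𝔸)`**: dividing a Siegel element by the Levi element of its `Δ`-block leaves an element acting trivially on `Δ`,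
hence in `N_Δ(𝔸)` (★ `mem_unipDelta_of_deltaBlock_eq_one`). [cite: MoeglinWaldspurger1995, I.2.1] [cite: HarrisKudlaSweet1996, §1 (1.11)–(1.12)] -/
theorem levi_inv_mul_mem_unipDelta (hdV0 : ∀ i, dV i ≠ 0) (hdW0 : ∀ i, dW i ≠ 0) {p : HA L e dV hdV dW hdW} (hp : IsSiegelDelta L e dV hdV dW hdW p)
    {g : GL (Fin n) (AdeleRing (𝓞 L) L)} (hg : (g : Matrix (Fin n) (Fin n) (AdeleRing (𝓞 L) L)) = deltaBlock L e dV hdV dW hdW p) :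
    (Λ g)⁻¹ * p ∈ unipDelta L e dV hdV dW hdW := by
  have hΛP : IsSiegelDelta L e dV hdV dW hdW (Λ g)⁻¹ :=
    isSiegelDelta_inv L e dV hdV dW hdW (isSiegelDelta_levi_apply L e dV hdV dW hdW Λ hΛ g)
  refine mem_unipDelta_of_deltaBlock_eq_one L e dV hdV dW hdW hdV0 hdW0 (isSiegelDelta_mul L e dV hdV dW hdW hΛP hp) ?_
  rw [deltaBlock_mul L e dV hdV dW hdW hΛP hp, deltaBlock_levi_inv_apply L e dV hdV dW hdW Λ hΛ, ← hg, ← Units.val_mul, inv_mul_cancel, Units.val_one]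

include hΛ in
/-- **ADELIC LEVI DECOMPOSITION `P_Δ(𝔸) = Λ(GL_n(𝔸_L)) · N_Δ(𝔸)`**: every `p ∈ P_Δ(𝔸)` is `p = Λ g · n₀` with `g = p|_Δ ∈ GL_n(𝔸_L)` and `n₀ ∈ N_Δ(𝔸)`.
[cite: MoeglinWaldspurger1995, I.2.1] [cite: HarrisKudlaSweet1996, §1 (1.11)–(1.12)] -/
theorem exists_levi_mul_unip (hdV0 : ∀ i, dV i ≠ 0) (hdW0 : ∀ i, dW i ≠ 0) {p : HA L e dV hdV dW hdW} (hp : IsSiegelDelta L e dV hdV dW hdW p) :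
    ∃ (g : GL (Fin n) (AdeleRing (𝓞 L) L)) (n₀ : HA L e dV hdV dW hdW),
      (g : Matrix (Fin n) (Fin n) (AdeleRing (𝓞 L) L)) = deltaBlock L e dV hdV dW hdW p ∧ n₀ ∈ unipDelta L e dV hdV dW hdW ∧ p = Λ g * n₀ := by
  obtain ⟨g, hg⟩ := exists_gl_coe_eq_deltaBlock L e dV hdV dW hdW hp
  exact ⟨g, (Λ g)⁻¹ * p, hg, levi_inv_mul_mem_unipDelta L e dV hdV dW hdW Λ hΛ hdV0 hdW0 hp hg, by rw [mul_inv_cancel_left]⟩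

end Levi

/-! ## §2 The Levi law of `M f`, given the modulus of `Ad(p)` on `N_Δ(𝔸)` -/

/-- **THE LEVI LAW OF THE SIEGEL INTERTWINING INTEGRAL.**  Let `νN` be a left-invariant measure on `N_Δ(𝔸)`, `f ∈ I(s, χ)` a Siegel section, and `p = m · n₀` with
`blk m = R·diag(A, D)·R⁻¹` (a Levi element of `H(𝔸)`), `n₀ ∈ N_Δ(𝔸)`, `p ∈ P_Δ(𝔸)`; suppose the conjugation `u ↦ p⁻¹ u p` of `N_Δ(𝔸)` scales `νN` by `θ`
(`hmod`, the modulus BY VALUE).  Then for every `h ∈ H(𝔸)`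
`M f (p h) = θ.toReal · δ_{χ,s}(w_Δ m w_Δ) · M f (h)`  (`δ_{χ,s}` = ★ `siegelDeltaCharacter χ s`; `w_Δ m w_Δ ∈ P_Δ(𝔸)` has blocks `diag(D, A)`).
No integrability is assumed: the substitution is a measurable equivalence, the scaling a scalar multiple of the measure, the rest a left translation.
[cite: MoeglinWaldspurger1995, II.1.6] [cite: HarrisKudlaSweet1996, §1 (1.15)] [cite: Garrett2018, §3.10] -/
theorem intertwiningDelta_levi_unip_mul
    [MeasurableSpace (unipDelta L e dV hdV dW hdW)] [BorelSpace (unipDelta L e dV hdV dW hdW)]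
    (νN : Measure (unipDelta L e dV hdV dW hdW)) [νN.IsMulLeftInvariant]
    {p m n₀ : HA L e dV hdV dW hdW} (hp : IsSiegelDelta L e dV hdV dW hdW p)
    {A D : Matrix (Fin n) (Fin n) (AdeleRing (𝓞 L) L)}
    (hm : blk L e dV hdV dW hdW m = cayR (AdeleRing (𝓞 L) L) (Fin n) * Matrix.fromBlocks A 0 0 D * cayRinv (AdeleRing (𝓞 L) L) (Fin n))
    (hn₀ : n₀ ∈ unipDelta L e dV hdV dW hdW) (hpm : p = m * n₀) (θ : ℝ≥0∞)
    (hmod : Measure.map (fun u : unipDelta L e dV hdV dW hdW =>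
        (⟨p⁻¹ * (u : HA L e dV hdV dW hdW) * p, conj_mem_unipDelta L e dV hdV dW hdW hp u.2⟩ : unipDelta L e dV hdV dW hdW)) νN = θ • νN)
    {χ : HeckeCharacter L} {s : ℂ} {f : HA L e dV hdV dW hdW → ℂ} (hf : IsSiegelDeltaSection L e dV hdV dW hdW χ s f) (h : HA L e dV hdV dW hdW) :
    intertwiningDelta L e dV hdV dW hdW νN f (p * h) =
      (θ.toReal : ℂ) * siegelDeltaCharacter L e dV hdV dW hdW χ s (weylDelta L e dV hdV dW hdW * m * weylDelta L e dV hdV dW hdW) *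
        intertwiningDelta L e dV hdV dW hdW νN f h := by
  have hmw : IsSiegelDelta L e dV hdV dW hdW (weylDelta L e dV hdV dW hdW * m * weylDelta L e dV hdV dW hdW) :=
    isSiegelDelta_of_blk_eq_levi L e dV hdV dW hdW (blk_weylDelta_mul_mul_weylDelta_of_blk_eq_levi L e dV hdV dW hdW hm)
  -- the conjugation `u ↦ p⁻¹ u p` as a homeomorphism of `N_Δ(𝔸)`
  have hmem' : ∀ u : unipDelta L e dV hdV dW hdW, p * (u : HA L e dV hdV dW hdW) * p⁻¹ ∈ unipDelta L e dV hdV dW hdW := fun u => by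
    have hu := conj_mem_unipDelta L e dV hdV dW hdW (isSiegelDelta_inv L e dV hdV dW hdW hp) u.2
    rwa [inv_inv] at hu
  let ε : unipDelta L e dV hdV dW hdW ≃ₜ unipDelta L e dV hdV dW hdW :=
    { toFun := fun u => ⟨p⁻¹ * (u : HA L e dV hdV dW hdW) * p, conj_mem_unipDelta L e dV hdV dW hdW hp u.2⟩
      invFun := fun u => ⟨p * (u : HA L e dV hdV dW hdW) * p⁻¹, hmem' u⟩
      left_inv := fun u => Subtype.ext (by
        show p * (p⁻¹ * (u : HA L e dV hdV dW hdW) * p) * p⁻¹ = u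
        simp only [mul_assoc, mul_inv_cancel_left, mul_inv_cancel, mul_one])
      right_inv := fun u => Subtype.ext (by
        show p⁻¹ * (p * (u : HA L e dV hdV dW hdW) * p⁻¹) * p = u
        simp only [mul_assoc, inv_mul_cancel_left, inv_mul_cancel, mul_one])
      continuous_toFun := Continuous.subtype_mk ((continuous_const.mul continuous_subtype_val).mul continuous_const) _
      continuous_invFun := Continuous.subtype_mk ((continuous_const.mul continuous_subtype_val).mul continuous_const) _ }
  have hε : Measure.map ε νN = θ • νN := hmod
  -- the integrand along the substitution: `w_Δ u (p h) = w_Δ p (p⁻¹ u p) h`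
  have hint : ∀ u : unipDelta L e dV hdV dW hdW,
      f (weylDelta L e dV hdV dW hdW * (u : HA L e dV hdV dW hdW) * (p * h)) =
        f (weylDelta L e dV hdV dW hdW * p * ((ε u : unipDelta L e dV hdV dW hdW) : HA L e dV hdV dW hdW) * h) := fun u => by
    show f _ = f (weylDelta L e dV hdV dW hdW * p * (p⁻¹ * (u : HA L e dV hdV dW hdW) * p) * h)
    congr 1
    simp only [mul_assoc, mul_inv_cancel_left]
  -- the section law at `w_Δ m w_Δ`: `w_Δ p v h = (w_Δ m w_Δ) · (w_Δ (n₀ v) h)`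
  have hsec : ∀ v : unipDelta L e dV hdV dW hdW,
      f (weylDelta L e dV hdV dW hdW * p * (v : HA L e dV hdV dW hdW) * h) =
        siegelDeltaCharacter L e dV hdV dW hdW χ s (weylDelta L e dV hdV dW hdW * m * weylDelta L e dV hdV dW hdW) *
          f (weylDelta L e dV hdV dW hdW * (((⟨n₀, hn₀⟩ : unipDelta L e dV hdV dW hdW) * v : unipDelta L e dV hdV dW hdW) : HA L e dV hdV dW hdW) * h) :=
    fun v => by
    rw [← hf _ hmw, hpm, Subgroup.coe_mul]
    congr 1
    simp only [mul_assoc]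
    rw [← mul_assoc (weylDelta L e dV hdV dW hdW) (weylDelta L e dV hdV dW hdW) (n₀ * ((v : HA L e dV hdV dW hdW) * h)),
      weylDelta_mul_weylDelta, one_mul]
  -- left invariance under `n₀`
  have hleft : ∫ v, f (weylDelta L e dV hdV dW hdW * (((⟨n₀, hn₀⟩ : unipDelta L e dV hdV dW hdW) * v : unipDelta L e dV hdV dW hdW) :
      HA L e dV hdV dW hdW) * h) ∂νN = ∫ v, f (weylDelta L e dV hdV dW hdW * (v : HA L e dV hdV dW hdW) * h) ∂νN :=
    integral_mul_left_eq_self (fun v : unipDelta L e dV hdV dW hdW => f (weylDelta L e dV hdV dW hdW * (v : HA L e dV hdV dW hdW) * h)) _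
  unfold intertwiningDelta
  calc ∫ u, f (weylDelta L e dV hdV dW hdW * (u : HA L e dV hdV dW hdW) * (p * h)) ∂νN
      = ∫ u, (fun v : unipDelta L e dV hdV dW hdW => f (weylDelta L e dV hdV dW hdW * p * (v : HA L e dV hdV dW hdW) * h))
          (ε.toMeasurableEquiv u) ∂νN := integral_congr_ae (Filter.Eventually.of_forall fun u => hint u)
    _ = ∫ v, f (weylDelta L e dV hdV dW hdW * p * (v : HA L e dV hdV dW hdW) * h) ∂(Measure.map ε.toMeasurableEquiv νN) :=
          (integral_map_equiv (μ := νN) ε.toMeasurableEquiv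
            (fun v : unipDelta L e dV hdV dW hdW => f (weylDelta L e dV hdV dW hdW * p * (v : HA L e dV hdV dW hdW) * h))).symm
    _ = ∫ v, f (weylDelta L e dV hdV dW hdW * p * (v : HA L e dV hdV dW hdW) * h) ∂(θ • νN) := by
          rw [Homeomorph.toMeasurableEquiv_coe, hε]
    _ = θ.toReal • ∫ v, f (weylDelta L e dV hdV dW hdW * p * (v : HA L e dV hdV dW hdW) * h) ∂νN := by
          rw [integral_smul_measure]
    _ = _ := by
          simp_rw [hsec, integral_const_mul, hleft, Complex.real_smul, mul_assoc]

/-! ## §3 The law for every `p ∈ P_Δ(𝔸)` -/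

section LeviLaw

variable (Λ : GL (Fin n) (AdeleRing (𝓞 L) L) →* HA L e dV hdV dW hdW)
  (hΛ : ∀ g : GL (Fin n) (AdeleRing (𝓞 L) L), blk L e dV hdV dW hdW (Λ g) =
    cayR (AdeleRing (𝓞 L) L) (Fin n) * Matrix.fromBlocks (g : Matrix (Fin n) (Fin n) (AdeleRing (𝓞 L) L)) 0 0
      (((gramR L e dV hdV dW hdW).map ((algebraMap L (AdeleRing (𝓞 L) L)).comp (algebraMap (Fp L) L)))⁻¹ *
        (((g⁻¹ : GL (Fin n) (AdeleRing (𝓞 L) L)) : Matrix (Fin n) (Fin n) (AdeleRing (𝓞 L) L)).map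
          (conjAdele (Fp L) L (IsCMField.complexConj L)))ᵀ *
        (gramR L e dV hdV dW hdW).map ((algebraMap L (AdeleRing (𝓞 L) L)).comp (algebraMap (Fp L) L))) *
      cayRinv (AdeleRing (𝓞 L) L) (Fin n))

include hΛ in
/-- **THE LEVI LAW FOR EVERY `p ∈ P_Δ(𝔸)`**: with `g = p|_Δ` (any `g ∈ GL_n(𝔸_L)` with matrix `deltaBlock p`) and the modulus `θ` of `u ↦ p⁻¹ u p` BY VALUE,
`M f (p h) = θ.toReal · δ_{χ,s}(w_Δ (Λ g) w_Δ) · M f (h)` for every Siegel section `f ∈ I(s, χ)` and every `h`.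
[cite: MoeglinWaldspurger1995, II.1.6] [cite: HarrisKudlaSweet1996, §1 (1.15)] [cite: Garrett2018, §3.10] -/
theorem intertwiningDelta_siegel_mul (hdV0 : ∀ i, dV i ≠ 0) (hdW0 : ∀ i, dW i ≠ 0)
    [MeasurableSpace (unipDelta L e dV hdV dW hdW)] [BorelSpace (unipDelta L e dV hdV dW hdW)]
    (νN : Measure (unipDelta L e dV hdV dW hdW)) [νN.IsMulLeftInvariant]
    {p : HA L e dV hdV dW hdW} (hp : IsSiegelDelta L e dV hdV dW hdW p)
    {g : GL (Fin n) (AdeleRing (𝓞 L) L)} (hg : (g : Matrix (Fin n) (Fin n) (AdeleRing (𝓞 L) L)) = deltaBlock L e dV hdV dW hdW p) (θ : ℝ≥0∞)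
    (hmod : Measure.map (fun u : unipDelta L e dV hdV dW hdW =>
        (⟨p⁻¹ * (u : HA L e dV hdV dW hdW) * p, conj_mem_unipDelta L e dV hdV dW hdW hp u.2⟩ : unipDelta L e dV hdV dW hdW)) νN = θ • νN)
    {χ : HeckeCharacter L} {s : ℂ} {f : HA L e dV hdV dW hdW → ℂ} (hf : IsSiegelDeltaSection L e dV hdV dW hdW χ s f) (h : HA L e dV hdV dW hdW) :
    intertwiningDelta L e dV hdV dW hdW νN f (p * h) =
      (θ.toReal : ℂ) * siegelDeltaCharacter L e dV hdV dW hdW χ s (weylDelta L e dV hdV dW hdW * Λ g * weylDelta L e dV hdV dW hdW) *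
        intertwiningDelta L e dV hdV dW hdW νN f h :=
  intertwiningDelta_levi_unip_mul L e dV hdV dW hdW νN hp (hΛ g) (levi_inv_mul_mem_unipDelta L e dV hdV dW hdW Λ hΛ hdV0 hdW0 hp hg)
    (by rw [mul_inv_cancel_left]) θ hmod hf h

end LeviLaw

end Summit.HodgeConjecture.HodgeConjecture.Cruxes.HLiu418.K2LiuIntertwiningDeltaLeviLaw

end
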